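import Summits.BirchSwinnertonDyer.BirchSwinnertonDyer.Theorems.GenusKolyvaginAtTwoGenusPrimitiveSupplyAtTwoConjugationTypeAtTwo
import Summits.BirchSwinnertonDyer.BirchSwinnertonDyer.Theorems.GenusKolyvaginAtTwoShaCardDvdPowAtTwoPosTSharpExponentRatOfRegularPairSupply
import HarnessLib

/-!
# Route `GenusKolyvaginAtTwo`, crux L⁺_T′ `PowDvdShaCardAtTwoPosT` (stmt-BirchSwinnertonDyer-25501) and the Δ>0 supply⁺″ — THE TRANSPOSITION CLAUSE
# IS DECIDED BY A POINT COUNT: «some Frobenius above `ℓ` moves a point of `E[2]`» ⟺ `#Ẽ(𝔽_ℓ)[2] ≠ 4` (the 2-division cubic does not split mod `ℓ`)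

Seat `bsd-line-gk2-p2` g22 (PROVER seat 2/3, cell `bsd-f1-sign2`), `--supports stmt-BirchSwinnertonDyer-25501` (helper; closes nothing).
THEOREMS ONLY (no definition, no named fact, no `sorry`).  BSD is NOT proved by any of this.

WHY.  The rev-48 texts of L⁺_T′ / Q4_T″ / supply⁺″ (R9-L, this seat; R9-FINAL, LEAD) carry the Kolyvagin witness at TRANSPOSITION-deep primes:
`Zhang2014.IsKolyvaginPrime N W K 2 ℓ ∧ 2 ≤ kolyvaginIndex W 2 ℓ ∧ ∃ v 𝔓 (h : Γ_ℚ), ℓ ∈ v ∧ 𝔓 ∈ v.primesAbove ∧ IsArithFrobAt (𝓞 ℚ) h 𝔓 ∧ ∃ u : E[2], h • u ≠ u`.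
The supply crux's stub C⁺ and every numerical certificate (cdisprove / -data) need a COMPUTABLE form of the last conjunct.  This file gives it, for
every odd prime `ℓ` of good reduction of the globally minimal `W/ℚ` (no sign of `Δ`, no field `K`):
* `transposition_of_natCard_twoTorsion_reductionAt_ne_four` — `#Ẽ_v(k_v)[2] ≠ 4` ⟹ the transposition clause at `ℓ`;
* `natCard_twoTorsion_reductionAt_ne_four_of_transposition` — the converse;
* `transposition_iff_natCard_twoTorsion_reductionAt_ne_four` — the dictionary.  (`#Ẽ(𝔽_ℓ)[2] ∈ {1, 2, 4}` = one plus the number of roots of the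
  2-division cubic mod `ℓ`; at a Zhang–Kolyvagin prime `a_ℓ` is even, which excludes the 3-cycle, so there the clause reads `#Ẽ(𝔽_ℓ)[2] = 2`.)
Mechanism: reduction identifies `Ẽ_v(k_v)[2]` with the fixed points on `E[2]` of an arithmetic Frobenius `σ₀` at some prime above `v`
(`GaloisImage.FrobShape.exists_frobenius_natCard_fixed_eq`, Silverman VII.3.1(b)); the primes above `ℓ` are conjugate and inertia acts trivially on
`E[2]` (VII.4.1(a)), so «SOME Frobenius moves a point» and «`σ₀` moves a point» agree; `#E[2] = 4` (III.6.4(b)).  (Adapted from gk2-p5's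
`GenusKolySign.natCard_twoTorsion_reductionAt_eq_four_of_frobEqFrobInfty_of_Δ_pos`, which is the Δ>0 Gross-class instance `= 4`.)

References: [SilvermanAEC2009] Prop. VII.3.1(b), Prop. VII.4.1(a), Cor. III.6.4(b); [GrossLMS1991] §3 (3.1)–(3.3); [WZhang2014] Notations (xii).
-/

set_option autoImplicit false
-- the Theorems namespace of this sub repeats the summit name by design (D-0017 nested layout)
set_option linter.dupNamespace false

noncomputable section

open scoped Classical
open WeierstrassCurve Field IsDedekindDomain NumberField
open Literature.NumberTheory.EllipticCurves Literature.NumberTheory.GaloisRepresentations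

namespace Summit.BirchSwinnertonDyer.BirchSwinnertonDyer.Theorems.GenusExact.PlusDescent

variable (W : WeierstrassCurve ℚ) [W.IsElliptic] [W.IsGloballyMinimal]

omit [W.IsElliptic] [W.IsGloballyMinimal] in
/-- A moved point of `E[(2 : ℤ)]` is a moved point of `E[((2 : ℕ) : ℤ)]` (the two spellings of the level; converse of gk2-p5's
`exists_smul_ne_two_of_natCast`). [folklore] -/
theorem exists_smul_ne_natCast_of_two {h : absoluteGaloisGroup ℚ} (hu : ∃ u : geomTorsion W (2 : ℤ), h • u ≠ u) :
    ∃ u : geomTorsion W ((2 : ℕ) : ℤ), h • u ≠ u := by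
  obtain ⟨u, hu⟩ := hu
  have hmem : (u : geomPoints W) ∈ geomTorsion W ((2 : ℕ) : ℤ) := by
    rw [mem_geomTorsion_iff]
    have h2 := (mem_geomTorsion_iff W _ (u : geomPoints W)).mp u.2
    exact_mod_cast h2
  refine ⟨⟨u, hmem⟩, fun heq ↦ hu ?_⟩
  have h1 := congrArg Subtype.val heq
  simp only [Literature.NumberTheory.EllipticCurves.AddSubgroup.torsionBy.coe_smul] at h1
  apply Subtype.ext
  simp only [Literature.NumberTheory.EllipticCurves.AddSubgroup.torsionBy.coe_smul]
  exact h1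

/-- **`#Ẽ(𝔽_ℓ)[2] ≠ 4` ⟹ the transposition clause at `ℓ`.**  `W/ℚ` globally minimal, `ℓ` an odd prime of good reduction, `v ∋ ℓ` the place of `ℚ`:
if the reduction has fewer than four `k_v`-rational `2`-torsion points then some arithmetic Frobenius at some prime of `\bar ℤ` above `ℓ` moves a
point of `E[2]` — in the spelling of the rev-48 witness clause of L⁺_T′ / Q4_T″ / supply⁺″ (`geomTorsion W 2`).
[cite: SilvermanAEC2009, Prop. VII.3.1(b), Cor. III.6.4(b)] -/
theorem transposition_of_natCard_twoTorsion_reductionAt_ne_four {ℓ : ℕ} [Fact ℓ.Prime] (hℓ2 : ℓ ≠ 2)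
    (hgoodℓ : W.HasGoodReductionAtPrime ℓ) {v : HeightOneSpectrum (𝓞 ℚ)} (hv : (ℓ : 𝓞 ℚ) ∈ v.asIdeal)
    (hne : Nat.card (AddSubgroup.torsionBy (W.reductionAt v).toAffine.Point ((2 : ℕ) : ℤ)) ≠ 4) :
    ∃ (v : HeightOneSpectrum (𝓞 ℚ)) (𝔓 : Ideal (absIntegers (𝓞 ℚ) ℚ)) (h : absoluteGaloisGroup ℚ),
      (ℓ : 𝓞 ℚ) ∈ v.asIdeal ∧ 𝔓 ∈ v.primesAbove ∧ IsArithFrobAt (𝓞 ℚ) h 𝔓 ∧ ∃ u : geomTorsion W 2, h • u ≠ u := by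
  haveI : Fact (Nat.Prime 2) := ⟨Nat.prime_two⟩
  obtain ⟨σ₀, 𝔓₀, h𝔓₀, hσ₀, hcount⟩ :=
    Summit.BirchSwinnertonDyer.Rank1Residual.GaloisImage.FrobShape.exists_frobenius_natCard_fixed_eq W 2 ℓ hℓ2 hgoodℓ hv
  have hc1 := hcount 1
  rw [pow_one] at hc1
  refine ⟨v, 𝔓₀, σ₀, hv, h𝔓₀, hσ₀, ?_⟩
  -- if `σ₀` fixed `E[2]` pointwise the count would be `#E[2] = 4`
  by_contra hnone
  push Not at hnone
  have hall : ∀ P : geomTorsion W ((2 : ℕ) : ℤ), σ₀ • P = P := by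
    intro P
    by_contra hP
    exact (exists_smul_ne_natCast_of_two W (PlusDescent.exists_smul_ne_two_of_natCast W ⟨P, hP⟩)).elim fun u hu ↦ by
      -- `u : E[((2:ℕ):ℤ)]` moved; but `hnone` says every point of `E[(2:ℤ)]` is fixed: transport back
      obtain ⟨u', hu'⟩ := PlusDescent.exists_smul_ne_two_of_natCast W ⟨u, hu⟩
      exact hu' (hnone u')
  have hfixAll : Nat.card {P : geomTorsion W ((2 : ℕ) : ℤ) // σ₀ • P = P} = Nat.card (geomTorsion W ((2 : ℕ) : ℤ)) :=
    Nat.card_congr (Equiv.subtypeUnivEquiv hall)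
  have hE : Nat.card (geomTorsion W ((2 : ℕ) : ℤ)) = 2 ^ 2 := card_torsionPoints_eq_sq_holds W (AlgebraicClosure ℚ) (by norm_num)
  apply hne
  rw [← hc1, hfixAll, hE]
  norm_num

/-- **The transposition clause at `ℓ` ⟹ `#Ẽ(𝔽_ℓ)[2] ≠ 4`.**  Same frame: if some arithmetic Frobenius above `ℓ` moves a point of `E[2]`, the
reduction does NOT have full rational `2`-torsion (the primes above `ℓ` are conjugate and inertia is trivial on `E[2]`, so the counting Frobenius
`σ₀` of VII.3.1(b) moves a point too). [cite: SilvermanAEC2009, Prop. VII.3.1(b), Prop. VII.4.1(a), Cor. III.6.4(b)] -/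
theorem natCard_twoTorsion_reductionAt_ne_four_of_transposition {ℓ : ℕ} [Fact ℓ.Prime] (hℓ2 : ℓ ≠ 2)
    (hgoodℓ : W.HasGoodReductionAtPrime ℓ) {v : HeightOneSpectrum (𝓞 ℚ)} (hv : (ℓ : 𝓞 ℚ) ∈ v.asIdeal)
    (hT : ∃ (v : HeightOneSpectrum (𝓞 ℚ)) (𝔓 : Ideal (absIntegers (𝓞 ℚ) ℚ)) (h : absoluteGaloisGroup ℚ),
      (ℓ : 𝓞 ℚ) ∈ v.asIdeal ∧ 𝔓 ∈ v.primesAbove ∧ IsArithFrobAt (𝓞 ℚ) h 𝔓 ∧ ∃ u : geomTorsion W 2, h • u ≠ u) :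
    Nat.card (AddSubgroup.torsionBy (W.reductionAt v).toAffine.Point ((2 : ℕ) : ℤ)) ≠ 4 := by
  haveI : Fact (Nat.Prime 2) := ⟨Nat.prime_two⟩
  have hℓp : ℓ.Prime := Fact.out
  obtain ⟨v', 𝔓, h, hv', h𝔓, hfr, hu⟩ := hT
  obtain ⟨P, hP⟩ := exists_smul_ne_natCast_of_two W hu
  -- the place above `ℓ` is unique
  have hvℓ : (Rat.HeightOneSpectrum.primesEquiv v : ℕ) = ℓ := primesEquiv_eq_of_natCast_mem hℓp hv
  have hvv : v' = v := by
    have h1 : (Rat.HeightOneSpectrum.primesEquiv v' : ℕ) = ℓ := primesEquiv_eq_of_natCast_mem hℓp hv'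
    exact Rat.HeightOneSpectrum.primesEquiv.injective (Subtype.ext (h1.trans hvℓ.symm))
  rw [hvv] at h𝔓
  -- the counting Frobenius `σ₀`
  obtain ⟨σ₀, 𝔓₀, h𝔓₀, hσ₀, hcount⟩ :=
    Summit.BirchSwinnertonDyer.Rank1Residual.GaloisImage.FrobShape.exists_frobenius_natCard_fixed_eq W 2 ℓ hℓ2 hgoodℓ hv
  have hc1 := hcount 1
  rw [pow_one] at hc1
  -- move `σ₀` to `𝔓` and compare with `h` up to inertia (trivial on `E[2]`)
  obtain ⟨g, hg⟩ := IsDedekindDomain.HeightOneSpectrum.exists_smul_eq_of_mem_primesAbove_holds h𝔓₀ h𝔓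
  have hσ₁ : IsArithFrobAt (𝓞 ℚ) (g * σ₀ * g⁻¹) 𝔓 := hg ▸ hσ₀.conj g
  have hI := hfr.mul_inv_mem_inertia hσ₁
  have hgood : W.HasGoodReductionAt v := (hasGoodReductionAtPrime_primesEquiv_iff_holds W v ℓ hvℓ).mp hgoodℓ
  have h2v : (2 : 𝓞 ℚ) ∉ v.asIdeal := fun h2 ↦
    hℓ2 (hvℓ.symm.trans (primesEquiv_eq_of_natCast_mem Nat.prime_two (by exact_mod_cast h2)))
  have h2v' : ((((2 : ℕ) : ℤ)) : 𝓞 ℚ) ∉ v.asIdeal := by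
    rw [Int.cast_natCast]; exact_mod_cast h2v
  have hσσ₁ : ∀ Q : geomTorsion W ((2 : ℕ) : ℤ), h • Q = (g * σ₀ * g⁻¹) • Q := fun Q ↦ by
    have h' := W.smul_geomTorsion_eq_of_mem_inertia hgood h2v' h𝔓 hI ((g * σ₀ * g⁻¹) • Q)
    rwa [mul_smul, inv_smul_smul] at h'
  -- `σ₀` moves `g⁻¹ • P`
  have hmove : σ₀ • (g⁻¹ • P) ≠ g⁻¹ • P := by
    intro heq
    apply hP
    rw [hσσ₁, mul_smul, mul_smul, heq, smul_inv_smul]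
  -- hence the fixed-point count is `< 4`
  intro h4
  rw [← hc1] at h4
  have hE : Nat.card (geomTorsion W ((2 : ℕ) : ℤ)) = 2 ^ 2 := card_torsionPoints_eq_sq_holds W (AlgebraicClosure ℚ) (by norm_num)
  haveI : Finite (geomTorsion W ((2 : ℕ) : ℤ)) := Nat.finite_of_card_ne_zero (by rw [hE]; norm_num)
  -- a subtype of full cardinality is everything
  have hall : ∀ Q : geomTorsion W ((2 : ℕ) : ℤ), σ₀ • Q = Q := by
    have hcard : Nat.card {Q : geomTorsion W ((2 : ℕ) : ℤ) // σ₀ • Q = Q} = Nat.card (geomTorsion W ((2 : ℕ) : ℤ)) := by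
      rw [h4, hE]; norm_num
    have hbij := (Subtype.val_injective (p := fun Q : geomTorsion W ((2 : ℕ) : ℤ) ↦ σ₀ • Q = Q)).bijective_of_nat_card_le hcard.ge
    intro Q
    obtain ⟨⟨Q', hQ'⟩, hQQ⟩ := hbij.2 Q
    rw [← hQQ]; exact hQ'
  exact hmove (hall _)

/-- **THE DICTIONARY: the transposition clause at `ℓ` ⟺ `#Ẽ(𝔽_ℓ)[2] ≠ 4`** (`W/ℚ` globally minimal, `ℓ` an odd prime of good reduction,
`v ∋ ℓ`).  This is how a numerical certificate (or the supply crux's stub C⁺) checks the Frobenius half of the rev-48 Kolyvagin witness clause: count the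
roots of the 2-division cubic modulo `ℓ`. [cite: SilvermanAEC2009, Prop. VII.3.1(b), Prop. VII.4.1(a), Cor. III.6.4(b)] [cite: WZhang2014, Notations (xii)] -/
theorem transposition_iff_natCard_twoTorsion_reductionAt_ne_four {ℓ : ℕ} [Fact ℓ.Prime] (hℓ2 : ℓ ≠ 2)
    (hgoodℓ : W.HasGoodReductionAtPrime ℓ) {v : HeightOneSpectrum (𝓞 ℚ)} (hv : (ℓ : 𝓞 ℚ) ∈ v.asIdeal) :
    (∃ (v : HeightOneSpectrum (𝓞 ℚ)) (𝔓 : Ideal (absIntegers (𝓞 ℚ) ℚ)) (h : absoluteGaloisGroup ℚ),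
      (ℓ : 𝓞 ℚ) ∈ v.asIdeal ∧ 𝔓 ∈ v.primesAbove ∧ IsArithFrobAt (𝓞 ℚ) h 𝔓 ∧ ∃ u : geomTorsion W 2, h • u ≠ u) ↔
    Nat.card (AddSubgroup.torsionBy (W.reductionAt v).toAffine.Point ((2 : ℕ) : ℤ)) ≠ 4 :=
  ⟨natCard_twoTorsion_reductionAt_ne_four_of_transposition W hℓ2 hgoodℓ hv,
    transposition_of_natCard_twoTorsion_reductionAt_ne_four W hℓ2 hgoodℓ hv⟩

end Summit.BirchSwinnertonDyer.BirchSwinnertonDyer.Theorems.GenusExact.PlusDescent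

end
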